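import Literature.IUT.HodgeTheaters.LocalFrobenioidsWitness
import HarnessLib

/-!
# NV-L5 `SplitTopMonoid.Hom`: the morphisms of `TM⊢` are inhabited — identities, and complex conjugation on
# the model object `(𝒪^▷_ℂ, (0,1])` ([IUTchI] Ex. 3.4 (ii); [AbsTopIII] Def. 5.6 (i))

S. Mochizuki, *Inter-universal Teichmüller theory I*, kurims manuscript (May 2020), Example 3.4 (ii) p. 81: the
category `TM⊢` of "split topological monoids" — objects `(C, C→)` with `C ≅ 𝒪^▷_ℂ`, `C^× × C→ ⥲ C`, morphisms
"isomorphisms of topological monoids `C₁ ⥲ C₂` that induce isomorphisms `C₁→ ⥲ C₂→`" [claim: Mochizuki2012,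
status: disputed] (D-0012 claim key, series status DISPUTED — this is a NON-VACUITY WITNESS file for abc-iut-L5-t2's
interface `SplitTopMonoid.Hom` (`LocalFrobenioidsArch.lean`); nothing of the series is asserted; no side is taken on
[IUTchIII] Cor. 3.12).  L5-lead RULINGS #27 row «NV-L5 SplitTopMonoid.Hom [hom]»; row E34ii/L01 of
`plan/L5/SUBDAG-IUTchI-Ex33-Ex34.md`.  PROOF-ONLY (no `def`): the witnesses are built inside the proofs.

* `SplitTopMonoid.Hom.nonempty_refl` — every object of `TM⊢` has its identity morphism [hom, any object];
* `SplitTopMonoid.nonempty_hom_ofComplex` — at the MODEL object `SplitTopMonoid.ofComplex = (𝒪^▷_ℂ, (0,1])`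
  (abc-iut-L5-t2's `LocalFrobenioidsWitness.lean`) [model];
* `SplitTopMonoid.exists_hom_ofComplex_ne_refl` — a NON-identity automorphism of the model object in `TM⊢`:
  complex conjugation on `𝒪^▷_ℂ` (continuous, involutive, fixes `(0,1]` pointwise) [model] — so `Aut_{TM⊢}(𝒪^▷_ℂ, (0,1])`
  is not trivial: the `TM⊢`-structure alone does not pin the holomorphic structure (cf. Ex. 3.4 (ii)'s use of the
  Aut-holomorphic orbispace `𝒜_{𝒟_v}` next to the object of `TM⊢`).
-/

namespace Literature.IUT.HodgeTheaters

open Complex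

/-- **Identities of `TM⊢`**: `Hom(M, M)` is inhabited for every split topological monoid `M` (the identity
isomorphism of topological monoids carries `C→` onto itself). [hom] ([IUTchI] Ex 3.4 (ii) p.81) [claim: Mochizuki2012, status: disputed] -/
theorem SplitTopMonoid.Hom.nonempty_refl (M : SplitTopMonoid) : Nonempty (SplitTopMonoid.Hom M M) :=
  ⟨{ iso := MulEquiv.refl _
     continuous := continuous_id
     continuous_symm := continuous_id
     map_vec := by
       ext x
       constructor
       · rintro ⟨y, hy, rfl⟩; exact hy
       · intro hx; exact ⟨x, hx, rfl⟩ }⟩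

/-- **`Hom_{TM⊢}` at the MODEL object `(𝒪^▷_ℂ, (0,1])`** (abc-iut-L5-t2's `SplitTopMonoid.ofComplex`) is inhabited.
[model] ([IUTchI] Ex 3.4 (ii) p.81) [claim: Mochizuki2012, status: disputed] -/
theorem SplitTopMonoid.nonempty_hom_ofComplex :
    Nonempty (SplitTopMonoid.Hom SplitTopMonoid.ofComplex SplitTopMonoid.ofComplex) :=
  SplitTopMonoid.Hom.nonempty_refl _

/-- **A non-identity automorphism of the model object of `TM⊢`: complex conjugation** on `𝒪^▷_ℂ` — a continuous
involutive automorphism of the topological monoid of nonzero elements of norm `≤ 1` which fixes `(0,1]` pointwise,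
hence a morphism `(𝒪^▷_ℂ, (0,1]) → (𝒪^▷_ℂ, (0,1])` of `TM⊢`, different from the identity (it moves `i/2`). [model]
([IUTchI] Ex 3.4 (ii) p.81) [claim: Mochizuki2012, status: disputed] -/
theorem SplitTopMonoid.exists_hom_ofComplex_ne_refl :
    ∃ f : SplitTopMonoid.Hom SplitTopMonoid.ofComplex SplitTopMonoid.ofComplex, f.iso ≠ MulEquiv.refl _ := by
  -- complex conjugation restricted to `𝒪^▷_ℂ = {z ≠ 0, ‖z‖ ≤ 1}`
  have hmem : ∀ z : unitDiscMonoid ℂ, (starRingEnd ℂ) (z : ℂ) ∈ unitDiscMonoid ℂ := fun z =>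
    ⟨(map_ne_zero _).mpr z.2.1, by rw [Complex.norm_conj]; exact z.2.2⟩
  let c : unitDiscMonoid ℂ → unitDiscMonoid ℂ := fun z => ⟨(starRingEnd ℂ) (z : ℂ), hmem z⟩
  have hc : ∀ z, ((c z : unitDiscMonoid ℂ) : ℂ) = (starRingEnd ℂ) (z : ℂ) := fun _ => rfl
  have hcc : ∀ z, c (c z) = z := fun z => Subtype.ext (by rw [hc, hc, Complex.conj_conj])
  have hcont : Continuous c := (Complex.continuous_conj.comp continuous_subtype_val).subtype_mk _
  let e : unitDiscMonoid ℂ ≃* unitDiscMonoid ℂ :=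
    { toFun := c
      invFun := c
      left_inv := hcc
      right_inv := hcc
      map_mul' := fun x y => Subtype.ext (by simp only [hc, Submonoid.coe_mul, map_mul]) }
  have he : ∀ z, ((e z : unitDiscMonoid ℂ) : ℂ) = (starRingEnd ℂ) (z : ℂ) := fun _ => rfl
  -- elements of `(0,1]` are real, hence fixed by conjugation
  have hfix : ∀ r : unitDiscMonoid ℂ, r ∈ Witness.vecC → e r = r := by
    rintro r ⟨s, -, -, hs⟩
    apply Subtype.ext
    rw [he]
    change ((r : unitDiscMonoid ℂ) : ℂ) = algebraMap ℝ ℂ s at hs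
    rw [hs, Complex.coe_algebraMap, Complex.conj_ofReal]
  refine ⟨{ iso := e, continuous := hcont, continuous_symm := hcont, map_vec := ?_ }, ?_⟩
  · -- `e` carries `(0,1]` onto itself (it fixes it pointwise)
    ext x
    constructor
    · rintro ⟨y, hy, rfl⟩
      change e y ∈ SplitTopMonoid.ofComplex.vec
      rw [hfix y hy]; exact hy
    · intro hx
      exact ⟨x, hx, hfix x hx⟩
  · -- `e ≠ id`: it moves `i/2 ∈ 𝒪^▷_ℂ`
    intro h
    have hI : (Complex.I / 2 : ℂ) ∈ unitDiscMonoid ℂ := by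
      refine ⟨div_ne_zero Complex.I_ne_zero two_ne_zero, ?_⟩
      rw [norm_div, Complex.norm_I, Complex.norm_two]; norm_num
    have h1 := congrArg (fun f : unitDiscMonoid ℂ ≃* unitDiscMonoid ℂ => ((f ⟨_, hI⟩ : unitDiscMonoid ℂ) : ℂ)) h
    change (starRingEnd ℂ) (Complex.I / 2) = Complex.I / 2 at h1
    rw [map_div₀, Complex.conj_I, map_ofNat] at h1
    have h2 : (Complex.I : ℂ) = 0 := by linear_combination (-1 : ℂ) * h1
    exact Complex.I_ne_zero h2

end Literature.IUT.HodgeTheaters
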